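import Literature.Geometry.Lorentzian.BogovskiiOperatorRegularity
import Literature.Geometry.Lorentzian.BogovskiiGluing
import Mathlib.Analysis.Distribution.AEEqOfIntegralContDiff
import HarnessLib

/-!
# The Bogovskiĭ-type operator `S`: `C²` regularity and the pointwise identity (S2)

(trunk G08 = T-LORENTZ; family `gr`; namespace `Literature.Geometry.Lorentzian.MaoOhTao`.)

Mao–Oh–Tao (arXiv:2308.13031), Lemma 2.3 (S2): for `f` with vanishing affine moments, `Σ_{ij} ∂_i∂_j (S_η f)^{ij} = f`.
`BogovskiiOperator.lean` / `BogovskiiGluing.lean` prove the **weak** form (paired with `∂_j∂_iψ`, `ψ ∈ C²_c`); this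
file upgrades it to the **pointwise** identity for `η, f ∈ C²_c`:

* `bogovskiiS η f i j` — the operator as a function (a name for the integral used throughout the series);
* `pd_bogovskiiS`, `contDiff_two_bogovskiiS`, `pd_pd_bogovskiiS` — `S_η f ∈ C²` for `η, f ∈ C²_c`, with
  `∂_k∂_m S_η f = S_{∂_k∂_mη} f + S_{∂_mη}∂_k f + S_{∂_kη}∂_m f + S_η ∂_k∂_m f` (from `∂_m S_η = S_{∂_mη} + S_η∂_m`,
  `BogovskiiOperatorRegularity.lean`);
* `sum_sum_pd_pd_bogovskiiS_eq` — **(S2) pointwise**: `Σ_i Σ_j ∂_i∂_j (S_η f)^{ij}(x) = f(x)` for every `x`, when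
  `∫ η = 1` and `∫ f = ∫ x_j f = 0` (weak identity + two integrations by parts + the fundamental lemma of the calculus
  of variations `ae_eq_of_integral_contDiff_smul_eq` + continuity).

## References

* Y. Mao, S.-J. Oh, T. Tao, arXiv:2308.13031 (2023), Lemma 2.3, p. 8 (key `MaoOhTao2023`).
-/

noncomputable section

open scoped RealInnerProductSpace Topology ContDiff
open Filter MeasureTheory Set Metric Function

namespace Literature.Geometry.Lorentzian

namespace MaoOhTao

variable {η f : E3 → ℝ} {R : ℝ}

/-- **The operator `S_η`** of Lemma 2.3 as a function:
`(S_η f)^{ij}(x) = ∫ w_y(|x − y|, (x − y)/|x − y|) (x − y)ᵢ(x − y)ⱼ/|x − y|³ f(y) dy`. [cite: MaoOhTao2023, Lemma 2.3] -/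
def bogovskiiS (η f : E3 → ℝ) (i j : Fin 3) (x : E3) : ℝ :=
  ∫ y : E3, bogovskiiWeight η y ‖x - y‖ (‖x - y‖⁻¹ • (x - y)) * ((x - y) i * ((x - y) j * (‖x - y‖ ^ 3)⁻¹)) * f y

/-- Unfolding `bogovskiiS`. [folklore] -/
theorem bogovskiiS_apply (η f : E3 → ℝ) (i j : Fin 3) (x : E3) :
    bogovskiiS η f i j x = ∫ y : E3, bogovskiiWeight η y ‖x - y‖ (‖x - y‖⁻¹ • (x - y)) *
      ((x - y) i * ((x - y) j * (‖x - y‖ ^ 3)⁻¹)) * f y := rfl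

/-- `S_η g` is continuous (`η, g ∈ C_c`). [cite: MaoOhTao2023, Lemma 2.3] -/
theorem continuous_bogovskiiS (hη : Continuous η) (hR : ∀ z : E3, R < ‖z‖ → η z = 0) {g : E3 → ℝ}
    (hg : Continuous g) (hgc : HasCompactSupport g) (i j : Fin 3) : Continuous (bogovskiiS η g i j) :=
  continuous_bogovskiiOperator hη hR hg hgc i j

/-- `S_η f ∈ C¹` (`η, f ∈ C¹_c`). [cite: MaoOhTao2023, Lemma 2.3] -/
theorem contDiff_one_bogovskiiS (hη : ContDiff ℝ 1 η) (hR : ∀ z : E3, R < ‖z‖ → η z = 0)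
    (hf : ContDiff ℝ 1 f) (hfc : HasCompactSupport f) (i j : Fin 3) : ContDiff ℝ 1 (bogovskiiS η f i j) :=
  contDiff_one_bogovskiiOperator hη hR hf hfc i j

/-- **`∂_m S_η f = S_{∂_mη} f + S_η ∂_m f`** (`η, f ∈ C¹_c`). [cite: MaoOhTao2023, Lemma 2.3] -/
theorem pd_bogovskiiS (hη : ContDiff ℝ 1 η) (hR : ∀ z : E3, R < ‖z‖ → η z = 0)
    (hf : ContDiff ℝ 1 f) (hfc : HasCompactSupport f) (i j m : Fin 3) :
    pd m (bogovskiiS η f i j) = fun x ↦ bogovskiiS (pd m η) f i j x + bogovskiiS η (pd m f) i j x :=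
  funext fun x ↦ pd_bogovskiiOperator hη hR hf hfc i j m x

/-- `∂_mη ∈ C^n` vanishes off `B̄_R` (an admissible cut-off of one degree less). [folklore] -/
theorem pd_eta_admissible (hR : ∀ z : E3, R < ‖z‖ → η z = 0) (m : Fin 3) :
    ∀ z : E3, R < ‖z‖ → pd m η z = 0 := fun z hz ↦ pd_eq_zero_of_norm_lt hR m z hz

/-- A continuous linear functional on `ℝ³` is the sum of its values on the basis times the coordinate functionals;
in particular `Dφ(x) = Σ_m ∂_mφ(x) · projₘ`. [folklore] -/
theorem fderiv_eq_sum_pd (φ : E3 → ℝ) (x : E3) :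
    fderiv ℝ φ x = ∑ m, pd m φ x • (EuclideanSpace.proj m : E3 →L[ℝ] ℝ) := by
  ext v
  have hv : v = ∑ m, v m • e m := by
    conv_lhs => rw [← (EuclideanSpace.basisFun (Fin 3) ℝ).sum_repr v]
    simp [e, EuclideanSpace.basisFun_apply]
  conv_lhs => rw [hv, map_sum]
  simp only [map_smul, smul_eq_mul, FunLike.coe_sum, Finset.sum_apply,
    FunLike.coe_smul, Pi.smul_apply, pd]
  refine Finset.sum_congr rfl fun m _ ↦ ?_
  simp [mul_comm]

/-- **`S_η f ∈ C²`** (`η, f ∈ C²_c`). [cite: MaoOhTao2023, Lemma 2.3] -/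
theorem contDiff_two_bogovskiiS (hη : ContDiff ℝ 2 η) (hR : ∀ z : E3, R < ‖z‖ → η z = 0)
    (hf : ContDiff ℝ 2 f) (hfc : HasCompactSupport f) (i j : Fin 3) : ContDiff ℝ 2 (bogovskiiS η f i j) := by
  have hη1 : ContDiff ℝ 1 η := hη.of_le (by norm_num)
  have hf1 : ContDiff ℝ 1 f := hf.of_le (by norm_num)
  rw [show (2 : WithTop ℕ∞) = 1 + 1 from rfl, contDiff_succ_iff_fderiv]
  refine ⟨(contDiff_one_bogovskiiS hη1 hR hf1 hfc i j).differentiable one_ne_zero, by rintro ⟨⟩, ?_⟩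
  have hfd : fderiv ℝ (bogovskiiS η f i j) =
      fun x ↦ ∑ m, pd m (bogovskiiS η f i j) x • (EuclideanSpace.proj m : E3 →L[ℝ] ℝ) :=
    funext fun x ↦ fderiv_eq_sum_pd _ x
  rw [hfd]
  refine ContDiff.sum fun m _ ↦ ?_
  have hpd : ContDiff ℝ 1 (pd m (bogovskiiS η f i j)) := by
    rw [pd_bogovskiiS hη1 hR hf1 hfc i j m]
    exact (contDiff_one_bogovskiiS (contDiff_pd (n := 1) hη m) (pd_eta_admissible hR m) hf1 hfc i j).add
      (contDiff_one_bogovskiiS hη1 hR (contDiff_pd (n := 1) hf m) (hasCompactSupport_pd hfc m) i j)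
  exact hpd.smul contDiff_const

/-- **Second partials**: `∂_k∂_m S_η f = S_{∂_k∂_mη} f + S_{∂_mη} ∂_k f + S_{∂_kη} ∂_m f + S_η ∂_k∂_m f` (`η, f ∈ C²_c`).
[cite: MaoOhTao2023, Lemma 2.3] -/
theorem pd_pd_bogovskiiS (hη : ContDiff ℝ 2 η) (hR : ∀ z : E3, R < ‖z‖ → η z = 0)
    (hf : ContDiff ℝ 2 f) (hfc : HasCompactSupport f) (i j k m : Fin 3) (x : E3) :
    pd k (pd m (bogovskiiS η f i j)) x =
      bogovskiiS (pd k (pd m η)) f i j x + bogovskiiS (pd m η) (pd k f) i j x +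
        (bogovskiiS (pd k η) (pd m f) i j x + bogovskiiS η (pd k (pd m f)) i j x) := by
  have hη1 : ContDiff ℝ 1 η := hη.of_le (by norm_num)
  have hf1 : ContDiff ℝ 1 f := hf.of_le (by norm_num)
  have hpη : ContDiff ℝ 1 (pd m η) := contDiff_pd (n := 1) hη m
  have hpf : ContDiff ℝ 1 (pd m f) := contDiff_pd (n := 1) hf m
  rw [pd_bogovskiiS hη1 hR hf1 hfc i j m]
  have h1 : ContDiff ℝ 1 (bogovskiiS (pd m η) f i j) :=
    contDiff_one_bogovskiiS hpη (pd_eta_admissible hR m) hf1 hfc i j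
  have h2 : ContDiff ℝ 1 (bogovskiiS η (pd m f) i j) :=
    contDiff_one_bogovskiiS hη1 hR hpf (hasCompactSupport_pd hfc m) i j
  rw [pd_add ((h1.differentiable one_ne_zero) x) ((h2.differentiable one_ne_zero) x),
    pd_bogovskiiS hpη (pd_eta_admissible hR m) hf1 hfc i j k,
    pd_bogovskiiS hη1 hR hpf (hasCompactSupport_pd hfc m) i j k]

/-- Integration by parts twice against a test function: `∫ S ∂_j∂_iψ = ∫ ψ ∂_i∂_j S` for `S ∈ C²`, `ψ ∈ C²_c`.
[folklore] -/
theorem integral_mul_pd_pd_eq {S ψ : E3 → ℝ} (hS : ContDiff ℝ 2 S) (hψ : ContDiff ℝ 2 ψ)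
    (hψc : HasCompactSupport ψ) (i j : Fin 3) :
    ∫ x, S x * pd j (pd i ψ) x = ∫ x, ψ x * pd i (pd j S) x := by
  have hS1 : ContDiff ℝ 1 S := hS.of_le (by norm_num)
  have hψ1 : ContDiff ℝ 1 ψ := hψ.of_le (by norm_num)
  calc ∫ x, S x * pd j (pd i ψ) x = ∫ x, pd j (pd i ψ) x * S x := by
        exact integral_congr_ae (ae_of_all _ fun x ↦ mul_comm _ _)
    _ = -∫ x, pd i ψ x * pd j S x :=
        integral_pd_mul_eq_neg (contDiff_pd (n := 1) hψ i) (hasCompactSupport_pd hψc i) hS1 j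
    _ = ∫ x, ψ x * pd i (pd j S) x := by
        rw [integral_pd_mul_eq_neg hψ1 hψc (contDiff_pd (n := 1) hS j) i, neg_neg]

/-- **(S2) pointwise**: `Σ_i Σ_j ∂_i∂_j (S_η f)^{ij}(x) = f(x)` for every `x`, for `η ∈ C²_c` with `∫ η = 1` and
`f ∈ C²_c` with vanishing affine moments `∫ f = ∫ y_l f = 0`. [cite: MaoOhTao2023, Lemma 2.3 (S2)] -/
theorem sum_sum_pd_pd_bogovskiiS_eq (hη : ContDiff ℝ 2 η) (hR : ∀ z : E3, R < ‖z‖ → η z = 0)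
    (hη1 : ∫ z : E3, η z = 1) (hf : ContDiff ℝ 2 f) (hfc : HasCompactSupport f)
    (hmom : ∀ μ, ∫ y : E3, f y * momentFn μ y = 0) (x : E3) :
    ∑ i, ∑ j, pd i (pd j (bogovskiiS η f i j)) x = f x := by
  have hηc1 : ContDiff ℝ 1 η := hη.of_le (by norm_num)
  set G : E3 → ℝ := fun x ↦ ∑ i, ∑ j, pd i (pd j (bogovskiiS η f i j)) x with hG
  have hS2 : ∀ i j, ContDiff ℝ 2 (bogovskiiS η f i j) := fun i j ↦ contDiff_two_bogovskiiS hη hR hf hfc i j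
  have hGc : Continuous G := by
    refine continuous_finsetSum _ fun i _ ↦ continuous_finsetSum _ fun j _ ↦ ?_
    exact (contDiff_pd (n := 0) (contDiff_pd (n := 1) (hS2 i j) j) i).continuous
  -- the weak identity, integrated by parts twice
  have key : ∀ ψ : E3 → ℝ, ContDiff ℝ ∞ ψ → HasCompactSupport ψ →
      ∫ x, ψ x • G x = ∫ x, ψ x • f x := by
    intro ψ hψ hψc
    have hψ2 : ContDiff ℝ 2 ψ := hψ.of_le (by norm_cast)
    have hweak := (bogovskiiOperator_weak_inverse hηc1 hR hη1 f hf.continuous hfc hmom ψ hψ2 hψc).2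
    simp only [smul_eq_mul]
    have hint : ∀ i j, Integrable fun x ↦ ψ x * pd i (pd j (bogovskiiS η f i j)) x := fun i j ↦
      (hψ.continuous.mul (contDiff_pd (n := 0) (contDiff_pd (n := 1) (hS2 i j) j) i).continuous)
        |>.integrable_of_hasCompactSupport hψc.mul_right
    calc ∫ x, ψ x * G x = ∫ x, ∑ i, ∑ j, ψ x * pd i (pd j (bogovskiiS η f i j)) x := by
          refine integral_congr_ae (ae_of_all _ fun x ↦ ?_)
          simp only [hG, Finset.mul_sum]
      _ = ∑ i, ∑ j, ∫ x, ψ x * pd i (pd j (bogovskiiS η f i j)) x := by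
          rw [integral_finsetSum _ fun i _ ↦ integrable_finsetSum _ fun j _ ↦ hint i j]
          exact Finset.sum_congr rfl fun i _ ↦ integral_finsetSum _ fun j _ ↦ hint i j
      _ = ∑ i, ∑ j, ∫ x, bogovskiiS η f i j x * pd j (pd i ψ) x := by
          refine Finset.sum_congr rfl fun i _ ↦ Finset.sum_congr rfl fun j _ ↦ ?_
          rw [integral_mul_pd_pd_eq (hS2 i j) hψ2 hψc i j]
      _ = ∫ x, f x * ψ x := hweak
      _ = ∫ x, ψ x * f x := integral_congr_ae (ae_of_all _ fun x ↦ mul_comm _ _)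
  have hae : ∀ᵐ x ∂(volume : Measure E3), G x = f x :=
    ae_eq_of_integral_contDiff_smul_eq hGc.locallyIntegrable hf.continuous.locallyIntegrable key
  exact congrFun ((hGc.ae_eq_iff_eq volume hf.continuous).1 hae) x

end MaoOhTao

end Literature.Geometry.Lorentzian

end
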